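import Summits.ValiantsHypothesis.ValiantsHypothesis.Theorems.BarrierLeverNaturalProofsSeparateVNPPermanent
import Literature.Computability.AlgebraicComplexity.HamiltonianCycleMonotone
import Literature.Computability.AlgebraicComplexity.ValiantHCCompleteness

/-!
# Route BarrierLever — item `NaturalProofsSeparateVNP` (stmt-ValiantsHypothesis-18972):
# the normal form is INTRINSIC TO `VNP`-COMPLETENESS — abstract form, and the Hamiltonian cycle
# polynomial in place of the permanent (cell valiant-natproofs, seat val-np-p4 gen 4)

`S := Theses.BarrierLever.NaturalProofsSeparateVNP`. The sibling file `…NaturalProofsSeparateVNPPermanent`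
(gen 3) proved the PERMANENT NORMAL FORM `S ↔ NaturalProofAgainstVP ℂ 2 (per_⌊√n⌋ framed)`. This file
records that nothing about the permanent is used beyond (i) `VNP`-completeness under p-projections,
(ii) projection-monotonicity in the index (`per_m ≤_p per_{m'}`) and (iii) membership in `VNP`:

* §1 ABSTRACT NORMAL FORM. `naturalProofAgainstVP_of_complete` — if every pointwise-`VNP₁` family
  (`h n ∈ SmallDefinable ℂ n 1`) is a polynomially-framed projection of `Q` then `S → NaturalProofAgainstVP ℂ 2 Q`;
  `naturalProofsSeparateVNP_of_eventually_smallDefinable` — if `Q n ∈ SmallDefinable ℂ n b₁` for all large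
  `n` then `NaturalProofAgainstVP ℂ a Q → S` (any `a`). So `S ↔ NaturalProofAgainstVP ℂ 2 Q` for every
  `VNP`-succinct family `Q` that is hard for pointwise-`VNP₁` under framed projections.
* §2 THE HAMILTONIAN CYCLE POLYNOMIAL. With `HC_n` (`hcPoly`, Bürgisser (2.3)) `VNP`-complete over
  every field (tree: `isVNPComplete_hcPoly_holds`, Valiant 1979 / BCS Thm. (21.17)), in `VNP`
  (`isVNPFamily_hcPoly_holds`) and projection-monotone (`isProjection_hcPoly_of_le`, this seat's
  Literature file `HamiltonianCycleMonotone`): **`S ↔ NaturalProofAgainstVP ℂ 2 (HC_⌊√n⌋ framed)`**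
  (`naturalProofsSeparateVNP_iff_naturalProofAgainstVP_hcFrame`), every level `a ≥ 2`; hence
  `NaturalProofAgainstVP ℂ 2 (per framed) ↔ NaturalProofAgainstVP ℂ 2 (HC framed)` — level-two
  algebraically natural proofs certify `per ∉ VP` infinitely often iff they certify `HC ∉ VP`
  infinitely often (`naturalProofAgainstVP_perFrame_iff_hcFrame`); and the corollaries under
  `PermanentExpHardWith` / the crux, as for the permanent.

The framing is the permanent file's: `HC_⌊√n⌋` renamed into the first `⌊√n⌋²` of the `n` variables,
written out as `rename (Fin.castLE (Nat.sqrt_le n) ∘ finProdFinEquiv) (hcPoly (Fin n.sqrt) ℂ)`;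
no definition is introduced.

WHAT THIS IS NOT: item 18972 stays OPEN (parked on the crux, item 14610; it implies `VP ≠ VNP`);
equivalences between open statements only; nothing here is evidence for `VP ≠ VNP`, for FSV
Question 6, or for hardness of `per` / `HC`. That natural proofs transfer along reductions is
folklore (GKSS 2017 §2, FSV 2018 §1.2).

References: [Valiant1979]; [Burgisser2000] (2.3), Def. 2.6, Def. 2.8, Thm. 2.10;
[BurgisserClausenShokrollahi1997] Thm. (21.17); [ForbesShpilkaVolk2018] Def. 1, §1.2, Question 6;
[KumarRamyaSaptharishiTengse2022] §1.2; [GrochowKumarSaksSaraf2017] §2.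
-/

-- layout Summits/ValiantsHypothesis/ValiantsHypothesis forces the duplicated namespace component
set_option linter.dupNamespace false

noncomputable section

namespace Summit.ValiantsHypothesis.ValiantsHypothesis.Theorems.BarrierLever.NaturalProofsSeparateVNP

open Literature.Barriers.ValiantsHypothesis Literature.Computability.AlgebraicComplexity MvPolynomial
open Summit.ValiantsHypothesis.ValiantsHypothesis.Theses
open Projections Permanent

/-! ### §1 The abstract normal form: any `VNP`-succinct family hard for pointwise-`VNP₁` -/

section Abstract

/-- **Item 18972 ⇒ a level-two natural proof against `VP` at any family that is HARD for
pointwise-`VNP₁` under polynomially framed projections.** If every family `h` with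
`h n ∈ SmallDefinable ℂ n 1` is, term by term, a projection of some `Q n'` with `n < n' ≤ A(n+1)^B`
and `deg Q n' ≤ n'`, then the item's separating natural proofs ascend to `Q`
(`naturalProofsSeparateVNP_iff_exists_family` + `Projections.naturalProofAgainstVP_of_projections`).
[cite: ForbesShpilkaVolk2018, Def. 1 and §1.2] [cite: Burgisser2000, Def. 2.8] -/
theorem naturalProofAgainstVP_of_complete {Q : ∀ n, MvPolynomial (Fin n) ℂ}
    (hQ : ∀ h : ∀ n, MvPolynomial (Fin n) ℂ, (∀ n, h n ∈ SmallDefinable ℂ n 1) →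
      ∃ A B : ℕ, ∀ n : ℕ, ∃ n' : ℕ, n < n' ∧ n' ≤ A * (n + 1) ^ B ∧
        (Q n').totalDegree ≤ n' ∧ IsProjection (h n) (Q n'))
    (hS : BarrierLever.NaturalProofsSeparateVNP) : NaturalProofAgainstVP ℂ 2 Q := by
  obtain ⟨h, hdef, hnat⟩ := naturalProofsSeparateVNP_iff_exists_family.mp hS
  exact naturalProofAgainstVP_of_projections (a := 1) hnat (hQ h hdef)

/-- **Conversely, at ANY level, for any eventually `VNP`-succinct family**: a level-`a` natural proof
against `VP` at `Q`, where `Q n ∈ SmallDefinable ℂ n b₁` for all large `n`, gives item 18972 (the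
item's level is immaterial, `naturalProofsSeparateVNP_of_level`).
[cite: ForbesShpilkaVolk2018, Question 6] [cite: KumarRamyaSaptharishiTengse2022, §1.2] -/
theorem naturalProofsSeparateVNP_of_eventually_smallDefinable {Q : ∀ n, MvPolynomial (Fin n) ℂ}
    (hQ : ∃ b₁ n₁ : ℕ, ∀ n : ℕ, n₁ ≤ n → Q n ∈ SmallDefinable ℂ n b₁) (a : ℕ)
    (hnat : NaturalProofAgainstVP ℂ a Q) : BarrierLever.NaturalProofsSeparateVNP := by
  obtain ⟨b₁, n₁, hmem⟩ := hQ
  refine naturalProofsSeparateVNP_of_level a ⟨b₁, fun b n₀ => ?_⟩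
  obtain ⟨n, hn, D, hD, hne⟩ := hnat b (max n₀ n₁)
  exact ⟨n, (le_max_left _ _).trans hn, D, hD, _, hmem n ((le_max_right _ _).trans hn), hne⟩

/-- **Abstract normal form of item 18972.** For a family `Q` that is eventually `VNP`-succinct and
hard for pointwise-`VNP₁` under framed projections, `S ↔ NaturalProofAgainstVP ℂ 2 Q`.
[cite: ForbesShpilkaVolk2018, Def. 1 and Question 6] [cite: Burgisser2000, Def. 2.8] -/
theorem naturalProofsSeparateVNP_iff_naturalProofAgainstVP_of_complete {Q : ∀ n, MvPolynomial (Fin n) ℂ}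
    (hQ : ∀ h : ∀ n, MvPolynomial (Fin n) ℂ, (∀ n, h n ∈ SmallDefinable ℂ n 1) →
      ∃ A B : ℕ, ∀ n : ℕ, ∃ n' : ℕ, n < n' ∧ n' ≤ A * (n + 1) ^ B ∧
        (Q n').totalDegree ≤ n' ∧ IsProjection (h n) (Q n'))
    (hQ' : ∃ b₁ n₁ : ℕ, ∀ n : ℕ, n₁ ≤ n → Q n ∈ SmallDefinable ℂ n b₁) :
    BarrierLever.NaturalProofsSeparateVNP ↔ NaturalProofAgainstVP ℂ 2 Q :=
  ⟨naturalProofAgainstVP_of_complete hQ, naturalProofsSeparateVNP_of_eventually_smallDefinable hQ' 2⟩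

end Abstract

/-! ### §2 The Hamiltonian cycle polynomial, framed in the FSV regime -/

namespace Hamiltonian

section Framing

/-- The framed Hamiltonian cycle polynomial `HC_⌊√n⌋` (in the first `⌊√n⌋²` of `n` variables) has
degree `⌊√n⌋ ≤ n` (`HC_s` is homogeneous of degree `s`, `hcPoly_isHomogeneous`).
[cite: Burgisser2000, (2.3)] -/
theorem totalDegree_hcFrame_le (n : ℕ) :
    (rename (Fin.castLE (Nat.sqrt_le n) ∘ finProdFinEquiv) (hcPoly (Fin n.sqrt) ℂ)).totalDegree ≤ n := by
  refine (totalDegree_rename_le _ _).trans ?_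
  have h := (hcPoly_isHomogeneous (n := Fin n.sqrt) (k := ℂ)).totalDegree_le
  rw [Fintype.card_fin] at h
  exact h.trans (Nat.sqrt_le_self n)

/-- `HC_m` is a projection of the framed Hamiltonian cycle polynomial at frame `m²` (`⌊√(m²)⌋ = m`;
pad by `isProjection_hcPoly_of_le`, then un-rename). [cite: Burgisser2000, Def. 2.6] -/
theorem isProjection_hcPoly_hcFrame (m : ℕ) :
    IsProjection (hcPoly (Fin m) ℂ)
      (rename (Fin.castLE (Nat.sqrt_le (m * m)) ∘ finProdFinEquiv) (hcPoly (Fin (m * m).sqrt) ℂ)) :=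
  IsProjection.trans_holds (isProjection_hcPoly_of_le ℂ (Nat.sqrt_eq m).ge)
    (isProjection_rename_of_injective (frameEmb_injective (m * m)) _)

/-- **The framed Hamiltonian cycle polynomial is eventually in the `VNP`-succinct class**
`SmallDefinable ℂ n b₁` for ONE exponent `b₁` (`(HC_n) ∈ VNP`, the tree's `isVNPFamily_hcPoly_holds`,
BCS Prop. (21.15); rename the Boolean-sum witness into the frame, `boolSum_rename_sumMap`).
[cite: BurgisserClausenShokrollahi1997, Prop. (21.15)] [cite: Burgisser2000, Def. 2.5] -/
theorem hcFrame_mem_smallDefinable_eventually :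
    ∃ b₁ n₁ : ℕ, ∀ n : ℕ, n₁ ≤ n →
      rename (Fin.castLE (Nat.sqrt_le n) ∘ finProdFinEquiv) (hcPoly (Fin n.sqrt) ℂ) ∈
        SmallDefinable ℂ n b₁ := by
  obtain ⟨-, u, g, ⟨⟨hcard, hgdeg⟩, hgcomp⟩, hgeq⟩ := isVNPFamily_hcPoly_holds ℂ
  obtain ⟨A₁, B₁, h₁⟩ := (IsPBounded.iff_exists_le_mul_succ_pow _).1 hcard
  obtain ⟨A₂, B₂, h₂⟩ := (IsPBounded.iff_exists_le_mul_succ_pow _).1 hgdeg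
  obtain ⟨A₃, B₃, h₃⟩ := (IsPBounded.iff_exists_le_mul_succ_pow _).1 hgcomp
  set A := A₁ + A₂ + A₃ with hA
  set B := B₁ + B₂ + B₃ with hB
  refine ⟨B + 1, A * 2 ^ B + 1, fun n hn => ?_⟩
  set s := n.sqrt with hs
  have hsn : s ≤ n := Nat.sqrt_le_self n
  have absorb : ∀ {q Aᵢ Bᵢ : ℕ}, q ≤ Aᵢ * (s + 1) ^ Bᵢ → Aᵢ ≤ A → Bᵢ ≤ B → q ≤ n ^ (B + 1) := by
    intro q Aᵢ Bᵢ hq hAᵢ hBᵢ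
    calc q ≤ Aᵢ * (s + 1) ^ Bᵢ := hq
      _ ≤ A * (n + 1) ^ B := Nat.mul_le_mul hAᵢ
          ((Nat.pow_le_pow_left (by omega) _).trans (Nat.pow_le_pow_right (by omega) hBᵢ))
      _ ≤ n ^ (B + 1) := poly_absorb A B n hn
  have hu : u s ≤ n ^ (B + 1) := by
    refine absorb ((?_ : u s ≤ _).trans (h₁ s)) (by omega) (by omega)
    rw [Fintype.card_sum, Fintype.card_fin]
    exact Nat.le_add_left _ _
  refine ⟨totalDegree_hcFrame_le n, u s, hu,
    rename (Sum.map (Fin.castLE (Nat.sqrt_le n) ∘ finProdFinEquiv) id) (g s), ?_, ?_, ?_⟩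
  · exact absorb ((complexity_rename_le_holds' _ _).trans (h₃ s)) (by omega) (by omega)
  · exact absorb ((totalDegree_rename_le _ _).trans (h₂ s)) (by omega) (by omega)
  · rw [boolSum_rename_sumMap, ← hgeq s]

/-- **`HC` is hard for pointwise-`VNP₁` under framed projections**: every family `h` with
`h n ∈ SmallDefinable ℂ n 1` is a projection of `HC_{t(n)}` with `t` p-bounded (Valiant's
completeness theorem for `HC`, PROVED in the tree: `isVNPComplete_hcPoly_holds`, every field), hence
of `HC_m`, `m = t(n)+n+1` (`isProjection_hcPoly_of_le`), hence of the framed `HC` at `n' = m² > n`.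
[cite: Valiant1979] [cite: BurgisserClausenShokrollahi1997, Thm. (21.17)] -/
theorem hcFrame_complete (h : ∀ n, MvPolynomial (Fin n) ℂ) (hdef : ∀ n, h n ∈ SmallDefinable ℂ n 1) :
    ∃ A B : ℕ, ∀ n : ℕ, ∃ n' : ℕ, n < n' ∧ n' ≤ A * (n + 1) ^ B ∧
      (rename (Fin.castLE (Nat.sqrt_le n') ∘ finProdFinEquiv) (hcPoly (Fin n'.sqrt) ℂ)).totalDegree ≤ n' ∧
      IsProjection (h n) (rename (Fin.castLE (Nat.sqrt_le n') ∘ finProdFinEquiv) (hcPoly (Fin n'.sqrt) ℂ)) := by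
  obtain ⟨t, ht, hpr⟩ : IsPProjection h fun n => hcPoly (Fin n) ℂ :=
    (isVNPComplete_hcPoly_holds ℂ).2 (fun n => n) h (Border.isVNPFamily_of_mem_smallDefinable_one hdef)
  obtain ⟨A, B, hAB⟩ := (IsPBounded.iff_exists_le_mul_succ_pow t).1 ht
  refine ⟨(A + 1) ^ 2, 2 * B + 2, fun n => ?_⟩
  set m := t n + n + 1 with hm
  refine ⟨m * m, ?_, ?_, totalDegree_hcFrame_le (m * m), ?_⟩
  · calc n < (n + 1) * (n + 1) := by nlinarith
      _ ≤ m * m := Nat.mul_le_mul (by omega) (by omega)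
  · have hm' : m ≤ (A + 1) * (n + 1) ^ (B + 1) := by
      have h1 : (n + 1) ^ B ≤ (n + 1) ^ (B + 1) := Nat.pow_le_pow_right (by omega) (by omega)
      have h2 : n + 1 ≤ (n + 1) ^ (B + 1) := by
        calc n + 1 = (n + 1) ^ 1 := (pow_one _).symm
          _ ≤ (n + 1) ^ (B + 1) := Nat.pow_le_pow_right (by omega) (by omega)
      calc m = t n + (n + 1) := by rw [hm]; ring
        _ ≤ A * (n + 1) ^ B + (n + 1) := Nat.add_le_add_right (hAB n) _
        _ ≤ A * (n + 1) ^ (B + 1) + (n + 1) ^ (B + 1) := Nat.add_le_add (Nat.mul_le_mul_left A h1) h2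
        _ = (A + 1) * (n + 1) ^ (B + 1) := by ring
    calc m * m ≤ ((A + 1) * (n + 1) ^ (B + 1)) * ((A + 1) * (n + 1) ^ (B + 1)) :=
          Nat.mul_le_mul hm' hm'
      _ = (A + 1) ^ 2 * (n + 1) ^ (2 * B + 2) := by ring
  · exact IsProjection.trans_holds
      (IsProjection.trans_holds (hpr n) (isProjection_hcPoly_of_le ℂ (by omega : t n ≤ m)))
      (isProjection_hcPoly_hcFrame m)

end Framing

/-! ### The item is a natural proof against `VP` at the Hamiltonian cycle polynomial -/

section Main

/-- **Item 18972 ⇒ a level-two algebraically natural proof that `HC` is not in `VP`.**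
[cite: Valiant1979] [cite: ForbesShpilkaVolk2018, Def. 1 and §1.2] -/
theorem naturalProofAgainstVP_hcFrame_of_naturalProofsSeparateVNP
    (hS : BarrierLever.NaturalProofsSeparateVNP) :
    NaturalProofAgainstVP ℂ 2
      (fun n => rename (Fin.castLE (Nat.sqrt_le n) ∘ finProdFinEquiv) (hcPoly (Fin n.sqrt) ℂ)) :=
  naturalProofAgainstVP_of_complete hcFrame_complete hS

/-- **Conversely, at ANY level**: a level-`a` natural proof against `VP` at the framed `HC` gives
item 18972. [cite: BurgisserClausenShokrollahi1997, Prop. (21.15)] [cite: ForbesShpilkaVolk2018, Question 6] -/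
theorem naturalProofsSeparateVNP_of_naturalProofAgainstVP_hcFrame (a : ℕ)
    (hnat : NaturalProofAgainstVP ℂ a
      (fun n => rename (Fin.castLE (Nat.sqrt_le n) ∘ finProdFinEquiv) (hcPoly (Fin n.sqrt) ℂ))) :
    BarrierLever.NaturalProofsSeparateVNP :=
  naturalProofsSeparateVNP_of_eventually_smallDefinable hcFrame_mem_smallDefinable_eventually a hnat

/-- **HAMILTONIAN NORMAL FORM of item 18972**: `NaturalProofsSeparateVNP` holds iff there is a
level-two algebraically natural proof against `VP` AT THE HAMILTONIAN CYCLE POLYNOMIAL (framed as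
`HC_⌊√n⌋` in the first `⌊√n⌋²` of `n` variables) — the twin of the permanent normal form
`Permanent.naturalProofsSeparateVNP_iff_naturalProofAgainstVP_perFrame`, valid because only
`VNP`-completeness, index-monotonicity and `VNP`-membership of the target are used.
[cite: Valiant1979] [cite: ForbesShpilkaVolk2018, Def. 1, §1.2 and Question 6] -/
theorem naturalProofsSeparateVNP_iff_naturalProofAgainstVP_hcFrame :
    BarrierLever.NaturalProofsSeparateVNP ↔ NaturalProofAgainstVP ℂ 2
      (fun n => rename (Fin.castLE (Nat.sqrt_le n) ∘ finProdFinEquiv) (hcPoly (Fin n.sqrt) ℂ)) :=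
  ⟨naturalProofAgainstVP_hcFrame_of_naturalProofsSeparateVNP,
    naturalProofsSeparateVNP_of_naturalProofAgainstVP_hcFrame 2⟩

/-- The same at every level `a ≥ 2`. [cite: ForbesShpilkaVolk2018, Cor. 5] -/
theorem naturalProofsSeparateVNP_iff_naturalProofAgainstVP_hcFrame_level {a : ℕ} (ha : 2 ≤ a) :
    BarrierLever.NaturalProofsSeparateVNP ↔ NaturalProofAgainstVP ℂ a
      (fun n => rename (Fin.castLE (Nat.sqrt_le n) ∘ finProdFinEquiv) (hcPoly (Fin n.sqrt) ℂ)) :=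
  ⟨fun hS => naturalProofAgainstVP_mono ha (naturalProofAgainstVP_hcFrame_of_naturalProofsSeparateVNP hS),
    naturalProofsSeparateVNP_of_naturalProofAgainstVP_hcFrame a⟩

/-- **Permanent ⟺ Hamiltonian cycles, for natural proofs.** Level-two algebraically natural proofs
certify `per ∉ VP` (infinitely often against every polynomial size) iff they certify `HC ∉ VP` —
both being equivalent to item 18972. [cite: Valiant1979] [cite: ForbesShpilkaVolk2018, §1.2] -/
theorem naturalProofAgainstVP_perFrame_iff_hcFrame :
    NaturalProofAgainstVP ℂ 2
        (fun n => rename (Fin.castLE (Nat.sqrt_le n) ∘ finProdFinEquiv) (perPoly (Fin n.sqrt) ℂ)) ↔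
      NaturalProofAgainstVP ℂ 2
        (fun n => rename (Fin.castLE (Nat.sqrt_le n) ∘ finProdFinEquiv) (hcPoly (Fin n.sqrt) ℂ)) :=
  naturalProofsSeparateVNP_iff_naturalProofAgainstVP_perFrame.symm.trans
    naturalProofsSeparateVNP_iff_naturalProofAgainstVP_hcFrame

/-- Under exponential hardness of the permanent: FSV Question 6 fails over `ℂ` (¬ crux) iff level-two
natural proofs certify `HC ∉ VP` infinitely often. [cite: KumarRamyaSaptharishiTengse2022, Thm. MainThm and §1.2] [cite: ForbesShpilkaVolk2018, Question 6] -/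
theorem naturalProofAgainstVP_hcFrame_iff_not_crux {c m₀ : ℕ} (hper : PermanentExpHardWith ℂ c m₀) :
    NaturalProofAgainstVP ℂ 2
        (fun n => rename (Fin.castLE (Nat.sqrt_le n) ∘ finProdFinEquiv) (hcPoly (Fin n.sqrt) ℂ)) ↔
      ¬ BarrierLever.SuccinctHittingSetsForVP :=
  naturalProofsSeparateVNP_iff_naturalProofAgainstVP_hcFrame.symm.trans
    (naturalProofsSeparateVNP_iff_not_crux hper)

/-- Unconditionally: item 18967 `KRSTForVP` holds, or level-two natural proofs certify `HC ∉ VP`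
infinitely often. [cite: KumarRamyaSaptharishiTengse2022, §1.2] -/
theorem krstForVP_or_naturalProofAgainstVP_hcFrame :
    BarrierLever.KRSTForVP ∨ NaturalProofAgainstVP ℂ 2
      (fun n => rename (Fin.castLE (Nat.sqrt_le n) ∘ finProdFinEquiv) (hcPoly (Fin n.sqrt) ℂ)) := by
  rcases naturalProofsSeparateVNP_or_krstForVP with hS | hK
  · exact Or.inr (naturalProofAgainstVP_hcFrame_of_naturalProofsSeparateVNP hS)
  · exact Or.inl hK

/-- And the crux (item 14610) forbids natural proofs against `VP` at `HC` at every level.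
[cite: ForbesShpilkaVolk2018, Cor. 5 and Question 6] -/
theorem not_naturalProofAgainstVP_hcFrame_of_crux (hQ : BarrierLever.SuccinctHittingSetsForVP) (a : ℕ) :
    ¬ NaturalProofAgainstVP ℂ a
      (fun n => rename (Fin.castLE (Nat.sqrt_le n) ∘ finProdFinEquiv) (hcPoly (Fin n.sqrt) ℂ)) :=
  fun hnat => not_naturalProofsSeparateVNP_of_crux hQ
    (naturalProofsSeparateVNP_of_naturalProofAgainstVP_hcFrame a hnat)

end Main

end Hamiltonian

/-! ### §3 The item puts every framed-complete family, and `HC` itself, outside `\overline{VP}`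
### (appended 2026-08-26, same seat) -/

section Border

/-- **`\overline{VP}` is closed under p-projections FROM any family of FORMS of p-bounded degree**
(the general form of `Border.isVPBarFamily_of_isPProjection_perPoly`): if `h` is a p-projection of
`Q`, each `Q n` homogeneous of degree `d n` with `d` p-bounded, and `\underline{L}(Q n)` is
p-bounded, then so is `\underline{L}(h_n)` — by `Border.approxComplexity_aeval_le_of_isHomogeneous`
(`\underline{L}(F(a)) ≤ (deg F + 2)² · \underline{L}(F)` for a form `F` and a projection `a`) and
closure of p-bounded functions under `+, ·, ∘`. [cite: BurgisserEtAl2011, §9.3] [cite: Burgisser2000, Def. 2.6] -/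
theorem isVPBarFamily_of_isPProjection_of_isHomogeneous {σ : ℕ → Type*} [∀ n, Fintype (σ n)]
    [∀ n, DecidableEq (σ n)] {Q : ∀ n, MvPolynomial (σ n) ℂ} {d : ℕ → ℕ}
    (hQ : ∀ n, (Q n).IsHomogeneous (d n)) (hd : IsPBounded d)
    {v : ℕ → ℕ} {h : ∀ n, MvPolynomial (Fin (v n)) ℂ}
    (hproj : IsPProjection h Q) (hbar : IsVPBarFamily Q) : IsVPBarFamily h := by
  obtain ⟨t, ht, hpr⟩ := hproj
  have hbound : ∀ n, approxComplexity (h n) ≤ (d (t n) + 2) ^ 2 * approxComplexity (Q (t n)) := by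
    intro n
    obtain ⟨a, ha, heq⟩ := hpr n
    rw [heq]
    refine Border.approxComplexity_aeval_le_of_isHomogeneous (hQ (t n)) a fun i => ?_
    rcases ha i with ⟨j, hj⟩ | ⟨c, hc⟩
    · rw [hj]; exact complexity_X_holds _
    · rw [hc]; exact complexity_C_holds _
  refine IsPBounded.mono ?_ hbound
  exact IsPBounded.mul_holds
    (IsPBounded.pow_holds (IsPBounded.add_holds (IsPBounded.comp_holds hd ht) (IsPBounded.const 2)) 2)
    (IsPBounded.comp_holds hbar ht)

/-- `\overline{VP}` is closed under p-projections from the Hamiltonian cycle family (`HC_n` is a form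
of degree `n`, `hcPoly_isHomogeneous`). [cite: BurgisserEtAl2011, §9.3] [cite: Burgisser2000, (2.3)] -/
theorem isVPBarFamily_of_isPProjection_hcPoly {v : ℕ → ℕ} {h : ∀ n, MvPolynomial (Fin (v n)) ℂ}
    (hproj : IsPProjection h fun n => hcPoly (Fin n) ℂ)
    (hhc : IsVPBarFamily fun n => hcPoly (Fin n) ℂ) : IsVPBarFamily h :=
  isVPBarFamily_of_isPProjection_of_isHomogeneous (Q := fun n => hcPoly (Fin n) ℂ) (d := fun n => n)
    (fun n => by simpa only [Fintype.card_fin] using (hcPoly_isHomogeneous (n := Fin n) (k := ℂ)))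
    IsPBounded.id hproj hhc

/-- **Item 18972 ⇒ `(HC_n) ∉ \overline{VP}`** — the Hamiltonian cycle polynomial has superpolynomial
APPROXIMATE (border) circuit complexity: the `VNP` family outside `\overline{VP}` of
`Border.exists_isVNPFamily_not_isVPBarFamily` is a p-projection of `HC` (Valiant's theorem, tree's
`isVNPComplete_hcPoly_holds`, every field), and `\overline{VP}` is closed under p-projections from
`HC`. Twin of `Border.not_isVPBarFamily_perPoly`. [cite: Valiant1979] [cite: BurgisserEtAl2011, §9.3] -/
theorem not_isVPBarFamily_hcPoly (hS : BarrierLever.NaturalProofsSeparateVNP) :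
    ¬ IsVPBarFamily fun n => hcPoly (Fin n) ℂ := by
  intro hhc
  obtain ⟨h, hVNP, hbar⟩ := Border.exists_isVNPFamily_not_isVPBarFamily hS
  exact hbar (isVPBarFamily_of_isPProjection_hcPoly
    ((isVNPComplete_hcPoly_holds ℂ).2 (fun n => n) h hVNP) hhc)

/-- **Item 18972 puts every framed family that is hard for pointwise-`VNP₁` outside `\overline{VP}`**
(in FSV's frame: `Q : ∀ n, MvPolynomial (Fin n) ℂ`): the item ascends to a level-two natural proof
at `Q` (`naturalProofAgainstVP_of_complete`), and natural proofs are border lower bounds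
(`Border.not_isVPBarFamily_of_naturalProofAgainstVP`). [cite: ForbesShpilkaVolk2018, §1.1] [cite: BurgisserEtAl2011, §9.3] -/
theorem not_isVPBarFamily_of_complete {Q : ∀ n, MvPolynomial (Fin n) ℂ}
    (hQ : ∀ h : ∀ n, MvPolynomial (Fin n) ℂ, (∀ n, h n ∈ SmallDefinable ℂ n 1) →
      ∃ A B : ℕ, ∀ n : ℕ, ∃ n' : ℕ, n < n' ∧ n' ≤ A * (n + 1) ^ B ∧
        (Q n').totalDegree ≤ n' ∧ IsProjection (h n) (Q n'))
    (hS : BarrierLever.NaturalProofsSeparateVNP) : ¬ IsVPBarFamily Q :=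
  Border.not_isVPBarFamily_of_naturalProofAgainstVP (naturalProofAgainstVP_of_complete hQ hS)

/-- In particular the framed Hamiltonian cycle polynomial (`HC_⌊√n⌋` in `n` variables) is outside
`\overline{VP}` under item 18972. [cite: BurgisserEtAl2011, §9.3] [cite: Valiant1979] -/
theorem Hamiltonian.not_isVPBarFamily_hcFrame (hS : BarrierLever.NaturalProofsSeparateVNP) :
    ¬ IsVPBarFamily
      (fun n => rename (Fin.castLE (Nat.sqrt_le n) ∘ finProdFinEquiv) (hcPoly (Fin n.sqrt) ℂ)) :=
  not_isVPBarFamily_of_complete Hamiltonian.hcFrame_complete hS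

end Border

end Summit.ValiantsHypothesis.ValiantsHypothesis.Theorems.BarrierLever.NaturalProofsSeparateVNP

end
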